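import Literature.Analysis.InnerProduct.OrbifoldLensSpacePolesAtOne
import HarnessLib

/-!
# Dividing the weights and `q` of an orbifold lens space by `gcd(p₁, p₂, q)` (Bari–Hunsicker 2019, §2.1), the triple-pole
# coefficient `2/|G|`, and Corollary 2.14 («isospectral spherical space forms have `|G| = |G'|`») without normalization

Layer `Literature/Analysis/InnerProduct`, namespace `Literature.Analysis.InnerProduct`; lane `lit-hodgefound`, prover seat
`lit-hodgefound-p06`, generation 46, row g46-#7. THEOREMS only (no definition, no instance, no notation, no named fact).
Companion of `OrbifoldLensSpacePolesAtOne.lean` (row g46-#6), which proves `(1 − z)³F(z) → (2/q)·#{l < q : q ∣ ls₁, q ∣ ls₂}`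
for the generating function `F` of `L(q; s₁, s₂)` with arbitrary integer weights and Corollary 2.14 for NORMALIZED weights
(`gcd(s₁, s₂, q) = 1`). Here the normalization itself is made a theorem and removed from the hypotheses.

## Source, verbatim (held text `paper:arxiv-1705.01412`)

N. Bari, E. Hunsicker, *Isospectrality for orbifold lens spaces*, Canad. J. Math. **72** (2020), arXiv:1705.01412, §2.1:
"For `n ≤ q₀`, let `p₁, …, p_n` be `n` integers. Note, if `g.c.d.(p₁, …, p_n, q) ≠ 1`, we can divide all the `p_i`'s and
`q` by this gcd to get a case where the `gcd = 1`. So, without loss of generality, we can assume `g.c.d.(p₁, …, p_n, q) = 1`.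
We denote by `g` the orthogonal matrix … Then `g` generates a cyclic subgroup `G = {g^l}_{l=1}^{q}` of order `q` of the
special orthogonal group `SO(2n)` … We define the lens space `L(q : p₁, …, p_n)` as follows: `L(q : p₁, …, p_n) = S^{2n−1}/G`.
… **Theorem 2.11.** … `F_G(z) = (1/|G|)∑_{g∈G}(1 − z²)/det(I_{2n} − gz)`. … **Corollary 2.14.** Let `S^{2n−1}/G` and
`S^{2n−1}/G'` be two isospectral spherical space forms. Then `|G| = |G'|`." (§3, Case 5, uses the same device: "if say
`gcd(x, py) = e > 0`, then we could divide `x`, `py` and `q` by `e` and get a lens space with fundamental group of order `q/e`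
instead of `q`".)

## As formalised

* §1 **`lensMonomialCount_mul_mul`**, **`lensMultiplicity_mul_mul`**: `dim E_{n(n+2)}` is the same for `(gq; gs₁, gs₂)` and
  `(q; s₁, s₂)`, `g ≥ 1` — the invariance condition `gq ∣ (a−b)gs₁ + (c−d)gs₂` is `q ∣ (a−b)s₁ + (c−d)s₂` (the two triples
  define the same group `⟨diag(γ^{gs₁}, γ^{gs₂})⟩`, `γ^g` a primitive `q`-th root of unity).
* §2 **`lensMultiplicity_eq_div_gcd`**: with `g = gcd(s₁, s₂, q)` (`Nat.gcd (Int.gcd s₁ s₂) q`),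
  `dim E(L(q; s₁, s₂)) = dim E(L(q/g; s₁/g, s₂/g))`, and **`coprime_gcd_div_gcd`**: `gcd(s₁/g, s₂/g, q/g) = 1`.
* §3 **`tendsto_one_sub_pow_three_mul_tsum_lensMultiplicity_gcd`**: `(1 − z)³F(z) → 2g/q = 2/|G|` for all weights
  (Theorem 2.11's `1/|G|` normalization seen at the pole `z = 1`), and **`card_filter_dvd_mul_eq_gcd`**:
  `#{l < q : q ∣ ls₁, q ∣ ls₂} = gcd(s₁, s₂, q)` (the kernel of `l ↦ g^l`), read off by comparing with row g46-#6's limit.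
* §4 **`div_gcd_eq_of_lensMultiplicity_eq`**: COROLLARY 2.14 for three-dimensional lens spaces with arbitrary weights —
  isospectral `L(q; p₁, p₂)`, `L(q'; p₁', p₂')` have `q/gcd(p₁, p₂, q) = q'/gcd(p₁', p₂', q')` (`= |G| = |G'|`).

## References

* [BariHunsicker2019] N. Bari, E. Hunsicker, *Isospectrality for orbifold lens spaces*, Canad. J. Math. 72 (2020)
  (arXiv:1705.01412), §2.1 (normalization, Theorem 2.11, Corollary 2.12, Corollary 2.14), §3 (Case 5, first paragraph).
* [IkedaYamamoto1979] A. Ikeda, Y. Yamamoto, *On the spectra of 3-dimensional lens spaces*, Osaka J. Math. 16 (1979) 447–469,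
  §3 (3.2)–(3.3), (3.11), Corollary 3.3.
-/

noncomputable section

open Finset Filter Topology Complex

namespace Literature.Analysis.InnerProduct

open _root_.Real _root_.Filter _root_.Topology


/-! ### §1 `L(gq; gs₁, gs₂)` and `L(q; s₁, s₂)` have the same invariant monomials -/

/-- **"If `gcd(p₁, …, p_n, q) ≠ 1`, we can divide all the `p_i`'s and `q` by this gcd"** at the level of the invariant
monomials: `gq ∣ (a−b)gs₁ + (c−d)gs₂ ↔ q ∣ (a−b)s₁ + (c−d)s₂`, so `dim P_k^G` is the same for `(gq; gs₁, gs₂)` and `(q; s₁, s₂)`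
(`g ≥ 1`). [cite: BariHunsicker2019, §2.1 (the normalization `gcd(p₁, …, p_n, q) = 1`)] -/
theorem lensMonomialCount_mul_mul (g q : ℕ) (hg : g ≠ 0) (s₁ s₂ : ℤ) (k : ℕ) :
    lensMonomialCount (g * q) (g * s₁) (g * s₂) k = lensMonomialCount q s₁ s₂ k := by
  unfold lensMonomialCount
  refine sum_congr rfl fun ij _ ↦ sum_congr rfl fun ab _ ↦ sum_congr rfl fun cd _ ↦ if_congr ?_ rfl rfl
  rw [show ((ab.1 : ℤ) - ab.2) * (g * s₁) + ((cd.1 : ℤ) - cd.2) * (g * s₂) =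
      (g : ℤ) * (((ab.1 : ℤ) - ab.2) * s₁ + ((cd.1 : ℤ) - cd.2) * s₂) by ring, Nat.cast_mul]
  exact mul_dvd_mul_iff_left (Nat.cast_ne_zero.mpr hg)

/-- **The multiplicities of `L(gq; gs₁, gs₂)` are those of `L(q; s₁, s₂)`** — the orbifold lens space only depends on the
group `G = ⟨diag(γ^{gs₁}, γ^{gs₂})⟩ = ⟨diag(γ'^{s₁}, γ'^{s₂})⟩`, `γ' = γ^g` a primitive `q`-th root of unity.
[cite: BariHunsicker2019, §2.1 (the normalization `gcd(p₁, …, p_n, q) = 1`)] -/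
theorem lensMultiplicity_mul_mul (g q : ℕ) (hg : g ≠ 0) (s₁ s₂ : ℤ) (k : ℕ) :
    lensMultiplicity (g * q) (g * s₁) (g * s₂) k = lensMultiplicity q s₁ s₂ k := by
  simp only [lensMultiplicity, lensMonomialCount_mul_mul g q hg s₁ s₂]

/-! ### §2 The normalization `gcd(s₁, s₂, q) = 1`: dividing by `g = gcd(s₁, s₂, q)` -/

/-- `g = gcd(gcd(s₁, s₂), q)` divides `q`, `s₁`, `s₂` and is nonzero for `q ≠ 0`. [folklore] -/
private theorem gcd_dvd_g7 (q : ℕ) (s₁ s₂ : ℤ) :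
    Nat.gcd (Int.gcd s₁ s₂) q ∣ q ∧ ((Nat.gcd (Int.gcd s₁ s₂) q : ℕ) : ℤ) ∣ s₁ ∧ ((Nat.gcd (Int.gcd s₁ s₂) q : ℕ) : ℤ) ∣ s₂ := by
  refine ⟨Nat.gcd_dvd_right _ _, ?_, ?_⟩
  · exact (Int.natCast_dvd_natCast.mpr (Nat.gcd_dvd_left (Int.gcd s₁ s₂) q)).trans (Int.gcd_dvd_left s₁ s₂)
  · exact (Int.natCast_dvd_natCast.mpr (Nat.gcd_dvd_left (Int.gcd s₁ s₂) q)).trans (Int.gcd_dvd_right s₁ s₂)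

/-- **Normalization**: with `g = gcd(s₁, s₂, q)`, `dim E_{n(n+2)}(L(q; s₁, s₂)) = dim E_{n(n+2)}(L(q/g; s₁/g, s₂/g))` for all `n`
("we can divide all the `p_i`'s and `q` by this gcd to get a case where the `gcd = 1`"). [cite: BariHunsicker2019, §2.1] -/
theorem lensMultiplicity_eq_div_gcd (q : ℕ) (hq : q ≠ 0) (s₁ s₂ : ℤ) (k : ℕ) :
    lensMultiplicity q s₁ s₂ k = lensMultiplicity (q / Nat.gcd (Int.gcd s₁ s₂) q)
      (s₁ / (Nat.gcd (Int.gcd s₁ s₂) q : ℕ)) (s₂ / (Nat.gcd (Int.gcd s₁ s₂) q : ℕ)) k := by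
  obtain ⟨hgq, hg₁, hg₂⟩ := gcd_dvd_g7 q s₁ s₂
  have hg0 : Nat.gcd (Int.gcd s₁ s₂) q ≠ 0 := Nat.pos_iff_ne_zero.mp (Nat.gcd_pos_of_pos_right _ (Nat.pos_of_ne_zero hq))
  have e := lensMultiplicity_mul_mul (Nat.gcd (Int.gcd s₁ s₂) q) (q / Nat.gcd (Int.gcd s₁ s₂) q) hg0
    (s₁ / (Nat.gcd (Int.gcd s₁ s₂) q : ℕ)) (s₂ / (Nat.gcd (Int.gcd s₁ s₂) q : ℕ)) k
  rwa [Nat.mul_div_cancel' hgq, Int.mul_ediv_cancel' hg₁, Int.mul_ediv_cancel' hg₂] at e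

/-- After the division the weights are normalized: `gcd(s₁/g, s₂/g, q/g) = 1`. [cite: BariHunsicker2019, §2.1] -/
theorem coprime_gcd_div_gcd (q : ℕ) (hq : q ≠ 0) (s₁ s₂ : ℤ) :
    (Int.gcd (s₁ / (Nat.gcd (Int.gcd s₁ s₂) q : ℕ)) (s₂ / (Nat.gcd (Int.gcd s₁ s₂) q : ℕ))).Coprime
      (q / Nat.gcd (Int.gcd s₁ s₂) q) := by
  set g : ℕ := Nat.gcd (Int.gcd s₁ s₂) q with hg
  obtain ⟨hgq, hg₁, hg₂⟩ := gcd_dvd_g7 q s₁ s₂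
  rw [← hg] at hgq hg₁ hg₂
  have hg0 : 0 < g := Nat.gcd_pos_of_pos_right _ (Nat.pos_of_ne_zero hq)
  set d : ℕ := Nat.gcd (Int.gcd (s₁ / (g : ℕ)) (s₂ / (g : ℕ))) (q / g) with hd
  -- `g·d` divides `s₁`, `s₂` and `q`, hence `g`; so `d = 1`
  have hd₁ : ((g * d : ℕ) : ℤ) ∣ s₁ := by
    have h1 : (d : ℤ) ∣ s₁ / (g : ℕ) :=
      (Int.natCast_dvd_natCast.mpr (Nat.gcd_dvd_left _ (q / g))).trans (Int.gcd_dvd_left _ _)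
    rw [← Int.mul_ediv_cancel' hg₁, Nat.cast_mul]
    exact mul_dvd_mul_left _ h1
  have hd₂ : ((g * d : ℕ) : ℤ) ∣ s₂ := by
    have h1 : (d : ℤ) ∣ s₂ / (g : ℕ) :=
      (Int.natCast_dvd_natCast.mpr (Nat.gcd_dvd_left _ (q / g))).trans (Int.gcd_dvd_right _ _)
    rw [← Int.mul_ediv_cancel' hg₂, Nat.cast_mul]
    exact mul_dvd_mul_left _ h1
  have hdq : g * d ∣ q := by
    rw [← Nat.mul_div_cancel' hgq]
    exact Nat.mul_dvd_mul_left g (Nat.gcd_dvd_right _ _)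
  have hdg : g * d ∣ g := by
    have h12 : g * d ∣ Int.gcd s₁ s₂ := Int.natCast_dvd_natCast.mp (Int.dvd_coe_gcd hd₁ hd₂)
    exact Nat.dvd_gcd h12 hdq
  have hd1 : d ∣ 1 := (Nat.mul_dvd_mul_iff_left hg0).mp (by rwa [mul_one])
  exact Nat.dvd_one.mp hd1

/-! ### §3 The pole of order three in closed form: `(1 − z)³F(z) → 2·gcd(s₁, s₂, q)/q = 2/|G|` -/

/-- **`(1 − z)³F(z) → 2g/q`, `g = gcd(s₁, s₂, q)`**, for every `q ≥ 1` and all integer weights: `|G| = q/g` for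
`G = ⟨diag(γ^{s₁}, γ^{s₂})⟩`, and the limit is `2/|G|` (Theorem 2.11 / (3.11) for the normalized space `L(q/g; s₁/g, s₂/g)`).
[cite: BariHunsicker2019, Theorem 2.11, Corollary 2.12, §2.1] [cite: IkedaYamamoto1979, §3 (3.11)] -/
theorem tendsto_one_sub_pow_three_mul_tsum_lensMultiplicity_gcd (q : ℕ) [NeZero q] (s₁ s₂ : ℤ) :
    Tendsto (fun z : ℂ ↦ (1 - z) ^ 3 * ∑' n : ℕ, (lensMultiplicity q s₁ s₂ n : ℂ) * z ^ n)
      (𝓝[Metric.ball 0 1] 1) (𝓝 (2 * (Nat.gcd (Int.gcd s₁ s₂) q : ℂ) / (q : ℂ))) := by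
  have hq : q ≠ 0 := NeZero.ne q
  have hgq : Nat.gcd (Int.gcd s₁ s₂) q ∣ q := Nat.gcd_dvd_right _ _
  have hg0 : Nat.gcd (Int.gcd s₁ s₂) q ≠ 0 :=
    Nat.pos_iff_ne_zero.mp (Nat.gcd_pos_of_pos_right _ (Nat.pos_of_ne_zero hq))
  haveI : NeZero (q / Nat.gcd (Int.gcd s₁ s₂) q) :=
    ⟨(Nat.div_pos (Nat.le_of_dvd (Nat.pos_of_ne_zero hq) hgq) (Nat.pos_of_ne_zero hg0)).ne'⟩
  have h := tendsto_one_sub_pow_three_mul_tsum_lensMultiplicity_of_coprime_gcd (q / Nat.gcd (Int.gcd s₁ s₂) q)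
    (coprime_gcd_div_gcd q hq s₁ s₂)
  simp only [← lensMultiplicity_eq_div_gcd q hq s₁ s₂] at h
  rwa [Nat.cast_div hgq (Nat.cast_ne_zero.mpr hg0), div_div_eq_mul_div] at h

/-- **The number of `l < q` with `g^l = 1` is `gcd(s₁, s₂, q)`**: comparing the two expressions for `lim (1 − z)³F(z)`.
[cite: BariHunsicker2019, §2.1, Corollary 2.12] -/
theorem card_filter_dvd_mul_eq_gcd (q : ℕ) [NeZero q] (s₁ s₂ : ℤ) :
    ((range q).filter fun l : ℕ ↦ (q : ℤ) ∣ l * s₁ ∧ (q : ℤ) ∣ l * s₂).card = Nat.gcd (Int.gcd s₁ s₂) q := by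
  have hqC : (q : ℂ) ≠ 0 := Nat.cast_ne_zero.mpr (NeZero.ne q)
  haveI : (𝓝[Metric.ball (0 : ℂ) 1] (1 : ℂ)).NeBot := mem_closure_iff_nhdsWithin_neBot.mp (by
    rw [closure_ball (0 : ℂ) one_ne_zero, Metric.mem_closedBall, dist_zero_right, norm_one])
  have e := tendsto_nhds_unique (tendsto_one_sub_pow_three_mul_tsum_lensMultiplicity_orbifold q s₁ s₂)
    (tendsto_one_sub_pow_three_mul_tsum_lensMultiplicity_gcd q s₁ s₂)
  rw [mul_comm (2 : ℂ), mul_div_assoc, mul_comm _ (2 / (q : ℂ))] at e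
  exact_mod_cast mul_left_cancel₀ (div_ne_zero two_ne_zero hqC) e

/-! ### §4 COROLLARY 2.14 for three-dimensional orbifold lens spaces, without normalization -/

/-- **COROLLARY 2.14 (Bari–Hunsicker 2019), three-dimensional lens spaces, general weights: "two isospectral spherical space
forms have `|G| = |G'|`."** If `L(q; p₁, p₂)` and `L(q'; p₁', p₂')` (any integer weights) have the same multiplicities
`dim E_{n(n+2)}` for all `n`, then the orders `|G| = q/gcd(p₁, p₂, q)` and `|G'| = q'/gcd(p₁', p₂', q')` of the two cyclic
groups agree. [cite: BariHunsicker2019, Corollary 2.14, Proposition 2.10, §2.1] -/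
theorem div_gcd_eq_of_lensMultiplicity_eq {q q' : ℕ} [NeZero q] [NeZero q'] {p₁ p₂ p₁' p₂' : ℤ}
    (h : ∀ n : ℕ, lensMultiplicity q p₁ p₂ n = lensMultiplicity q' p₁' p₂' n) :
    q / Nat.gcd (Int.gcd p₁ p₂) q = q' / Nat.gcd (Int.gcd p₁' p₂') q' := by
  have hq : q ≠ 0 := NeZero.ne q
  have hq' : q' ≠ 0 := NeZero.ne q'
  have hgq : Nat.gcd (Int.gcd p₁ p₂) q ∣ q := Nat.gcd_dvd_right _ _
  have hgq' : Nat.gcd (Int.gcd p₁' p₂') q' ∣ q' := Nat.gcd_dvd_right _ _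
  haveI : NeZero (q / Nat.gcd (Int.gcd p₁ p₂) q) :=
    ⟨(Nat.div_pos (Nat.le_of_dvd (Nat.pos_of_ne_zero hq) hgq) (Nat.gcd_pos_of_pos_right _ (Nat.pos_of_ne_zero hq))).ne'⟩
  haveI : NeZero (q' / Nat.gcd (Int.gcd p₁' p₂') q') :=
    ⟨(Nat.div_pos (Nat.le_of_dvd (Nat.pos_of_ne_zero hq') hgq') (Nat.gcd_pos_of_pos_right _ (Nat.pos_of_ne_zero hq'))).ne'⟩
  refine eq_of_lensMultiplicity_eq_of_coprime_gcd (coprime_gcd_div_gcd q hq p₁ p₂) (coprime_gcd_div_gcd q' hq' p₁' p₂')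
    fun n ↦ ?_
  rw [← lensMultiplicity_eq_div_gcd q hq, ← lensMultiplicity_eq_div_gcd q' hq', h n]

end Literature.Analysis.InnerProduct
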